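import Summits.ResolutionOfSingularities.ResolutionOfSingularities.Theorems.MarkedTransferCampaignW46MohWindowShadeAnchor
import Literature.AlgebraicGeometry.Resolution.AlterationsNormalFormBlowupChartsFormal
import HarnessLib

/-!
# [OURS · L1 W4.6 rung (iii)] The POLYNOMIAL purely inseparable surface window — the sub-regime of o1's `regimeMohWindowSurfaceInsep`
# on which this seat's ENTRANCE DOOR transports the shade model, and its rung statement (statement-only typing + nesting)

Cell `res-hironaka`, LADDER-RESOLUTION rung L (D-0089), slot W4.6 rung (iii) «purely inseparable `z^p = f(x, y)` with `ord f < 2p`»;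
seat res-L1-s46-pv-6 (gen 4), the OURS sibling invited by res-L1-type-o1's design point (PUR) of `…MohWindowSurface.lean` («a prover who
needs the strict purely-inseparable normal form asks for a sharper sibling»). Host route MarkedTransfer (`HypersurfaceOrderReduction`,
stmt-ResolutionOfSingularities-16155), `--supports … --as helper`; kind definition (TYPED-OURS: 4 definitions + pure-logic nesting).

WHAT IS TYPED
* `CampaignW46.germConst A ξ : K → 𝒪_{Z,ξ}` — the constants at a point of an ambient datum (germs of the constant sections, tree
  `sectionConst`); auxiliary vocabulary.
* `CampaignW46.MohWindowSurfacePolyAt p κ I` (ring level): `R` regular local of embedding dimension `3` and, for some regular system of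
  parameters `(x, y, z)` and some CLEANED polynomial `F ∈ K[y₀, y₁]` (no monomial all of whose exponents are divisible by `p`; Hauser's
  normal form of `z^p + F`) with `p < ord₀ F < 2p`, `I = (z^p + F(x, y))` — `F` read through the constants `κ`. This is the strict
  purely-inseparable normal form «`z^p = F(x, y)`, `F` a POLYNOMIAL free of `z`», i.e. exactly the states of this seat's shade model
  (`PointBlowup.State`, Hauser 2010 §F) anchored in the stalk; by `…MohWindowShadeAnchor.mohWindowSurfaceAt_of_anchor₂` it implies o1's
  `MohWindowSurfaceAt p R I` (`MohWindowSurfacePolyAt.mohWindowSurfaceAt`).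
* `CampaignW46.Regime.mohWindowSurfacePoly` — o1's regime of record `regimeMohWindowSurfaceInsep` (isolated singular locus, surface window
  germ of exponent `E.b = p` at every singular point, at EVERY stage) AND a polynomial presentation `MohWindowSurfacePolyAt p (germConst A ξ)
  J_ξ` at every `ξ ∈ Sing(E)`. A SUB-regime (`Regime.mohWindowSurfacePoly_le`).
* `CampaignW46.MohWindowSurfacePolyPermissiblyTerminates p K` — the résumé-free rung on the sub-regime (`PermissiblyTerminates`): NO infinite
  §2.1-permissible sequence all of whose stages lie in `Regime.mohWindowSurfacePoly`. Implied by o1's `MohWindowSurfaceInsepPermissiblyTerminates`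
  (antitonicity, `mohWindowSurfacePolyPermissiblyTerminates_of_insep`); implies the typed forms `Terminates`/`TerminatesNabla` for every
  `N`, `Rd` on the sub-regime (`terminates_and_terminatesNabla_of_mohWindowSurfacePolyPermissiblyTerminates`). TARGET of this seat's
  assembly (`…MohWindowShadePolyTerminates.lean`): PROVED over algebraically closed `K`.

DESIGN POINTS. (POLY) The presentation is demanded at every stage (regimes have no memory); the proof uses it only at the root of a hit
thread and TRANSPORTS it (`…MohWindowShadeAnchorStep.exists_anchor_step`), reading the window and isolatedness from the conjunct
`regimeMohWindowSurfaceInsep`. (CLEAN) Cleanedness is part of the normal form (Hauser 2010 §G); over a perfect field every `z^p + F` is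
cleaned by `z ↦ z + Q(x, y)`. (LET) Letters `Fin 2`: `y₀ ↦ x`, `y₁ ↦ y` (the model's frame `j = 0`, `i = 1`).
(VAC) VACUITY SELF-CHECK. Not trivially true: the kernel witnesses of the regime of record — res-D-pv-029's `(𝔸³_K, ((z^p + x^(p+1) +
y^(p+1)), p))` p499871, res-D-pv-008's growth/stall families — are polynomial purely-inseparable germs at the origin, so they are the
intended inhabitants; their membership in THIS regime additionally needs the routine identification of the stalk presentation through
`germConst` (NOT proved in this file — disclosed). Not trivially false for trivial reasons: arbitrarily long in-window chains exist
(res-L1-s46-pv-6 gen 2). AI-written; AI review is weaker than expert review. H. Hironaka, ms. 2017-03-23, Th. 16.6 p.84 l.4–20, Th. 16.13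
p.87 l.26–28 — scope only, under adjudication, not cited as fact. [Hironaka2017] References: H. Hauser, Bull. AMS 47 (2010) §§F–G.
[Hauser2010]
-/

noncomputable section

set_option linter.dupNamespace false -- mandated namespace of this single-conjunct summit

open CategoryTheory AlgebraicGeometry TopologicalSpace IsLocalRing

namespace Summit.ResolutionOfSingularities.ResolutionOfSingularities.Theorems

namespace CampaignW46

open Literature.AlgebraicGeometry.Resolution
open Literature.AlgebraicGeometry.Resolution.Hauser2010
open Literature.AlgebraicGeometry.Hironaka2017.S02Preliminaries
open Literature.AlgebraicGeometry.Hironaka2017.Datum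

universe u

variable {p : ℕ} [Fact p.Prime] {K : Type u} [Field K] [CharP K p]

/-! ## §1 Constants at a point -/

/-- [OURS · L1 W4.6] auxiliary vocabulary; NOT a statement of the manuscript. The CONSTANTS at a point `ξ` of an ambient datum over `K`:
the ring map `K → 𝒪_{Z,ξ}`, `l ↦` the germ at `ξ` of the constant section `l` (tree `sectionConst A.hom ⊤`). [folklore] -/
def germConst (A : AmbientDatum p K) (ξ : A.Z) : K →+* A.Z.presheaf.stalk ξ :=
  (A.Z.presheaf.germ ⊤ ξ (Opens.mem_top ξ)).hom.comp (sectionConst A.hom ⊤)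

/-! ## §2 The polynomial purely inseparable window (ring level) -/

/-- [OURS · L1 W4.6 rung (iii)] replaces the role of the hypothesis «purely inseparable SURFACE `z^p = F(x, y)`, `F` a polynomial with
`p < ord F < 2p`» (RESCUE-SEED W4.6 (iii)) READ IN THE STALK through constants `κ : K → R`; NOT a statement of the manuscript. `R` is a
regular local ring of embedding dimension `3` and, for some regular system of parameters `(x, y, z)` and some CLEANED polynomial
`F ∈ K[y₀, y₁]` (`deletePthPowers p F = F`: no monomial all of whose exponents are divisible by `p`) with `p < ord₀ F < 2p`,
`I = (z^p + F(x, y))` (`F(x, y) = eval₂ κ ![x, y] F`). The states of the shade model `PointBlowup.State` anchored in `R`.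
[cite: Hauser2010, §F (setting f = x^p + y^r g), §G (cleaning of p-th power monomials)] -/
def MohWindowSurfacePolyAt (p : ℕ) {K : Type u} [Field K] {R : Type u} [CommRing R] [IsLocalRing R] (κ : K →+* R)
    (I : Ideal R) : Prop :=
  IsRegularLocalRing R ∧ (maximalIdeal R).spanFinrank = 3 ∧
    ∃ x y z : R, Ideal.span {x, y, z} = maximalIdeal R ∧
      ∃ F : MvPolynomial (Fin 2) K, deletePthPowers p F = F ∧ (p : ℕ∞) < ordZero F ∧ ordZero F < (2 * p : ℕ) ∧
        I = Ideal.span {z ^ p + MvPolynomial.eval₂ κ ![x, y] F}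

/-- Reading `![x, y]` as the model's frame `y₀ ↦ x`, `y₁ ↦ y`. [folklore] -/
theorem vec2_eq_frame {R : Type u} (x y : R) : (![x, y] : Fin 2 → R) = fun l => if l = 0 then x else y := by
  funext l
  fin_cases l <;> rfl

omit [Fact p.Prime] [CharP K p] in
/-- **The polynomial window germ IS a surface window germ of exponent `p` in o1's sense** (`MohWindowSurfaceAt p R I`): this seat's
`…MohWindowShadeAnchor.mohWindowSurfaceAt_of_anchor₂` (`d := ord₀ F`, `f := F(x, y) ∈ (x, y)^d ∖ 𝔪^(d+1)` by quasi-regularity). NOT a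
statement of the manuscript. [folklore] -/
theorem MohWindowSurfacePolyAt.mohWindowSurfaceAt {R : Type u} [CommRing R] [IsLocalRing R] {κ : K →+* R} {I : Ideal R}
    (h : MohWindowSurfacePolyAt p κ I) : MohWindowSurfaceAt p R I := by
  obtain ⟨hR, h3, x, y, z, hxyz, F, -, hpF, hF2, hI⟩ := h
  rw [hI, vec2_eq_frame]
  exact MohWindowShadeAnchor.mohWindowSurfaceAt_of_anchor₂ hR h3 hxyz κ (j := (0 : Fin 2)) (i := 1) (by decide)
    (fun l => by fin_cases l <;> simp) hpF hF2

/-! ## §3 The regime and the rung -/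

/-- [OURS · L1 W4.6 rung (iii)] **Regime «POLYNOMIAL purely inseparable surface window»** — replaces the role of the restriction (iii) of
RESCUE-SEED W4.6 in dimension 3 in its strict normal form, read on the state `(Z, E)` at EVERY stage; NOT a statement of the manuscript:
o1's regime of record `regimeMohWindowSurfaceInsep` (isolated singular locus of closed points, surface window germ of exponent `E.b = p`
at every singular point) AND, at every `ξ ∈ Sing(E)`, a polynomial presentation `MohWindowSurfacePolyAt p (germConst A ξ) J_ξ`. [folklore] -/
def Regime.mohWindowSurfacePoly : Regime p K := fun A E =>
  regimeMohWindowSurfaceInsep A E ∧ ∀ ξ ∈ E.sing, MohWindowSurfacePolyAt p (germConst A ξ) (stalkIdeal E.J ξ)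

/-- Pure logic: the polynomial regime is a sub-regime of o1's regime of record. [folklore] -/
theorem Regime.mohWindowSurfacePoly_le (A : AmbientDatum p K) (E : IdealExponent A.Z) (h : Regime.mohWindowSurfacePoly A E) :
    regimeMohWindowSurfaceInsep A E :=
  h.1

/-- [OURS · L1 W4.6 rung (iii)] **RUNG (iii), POLYNOMIAL PURELY INSEPARABLE SURFACE WINDOW, résumé-free** — replaces the role of the
termination clause of Th. 16.13 p.87 l.26–28 («repeatedly but finitely many times») for the typed Th. 16.6 procedure restricted, at every
stage, to `Regime.mohWindowSurfacePoly`; NOT a statement of the manuscript: there is NO infinite §2.1-permissible sequence (standard ideal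
exponents, permissible centres — here single closed points —, blow-ups, controlled transforms) all of whose stages lie in the regime
(`PermissiblyTerminates`). PROVED over algebraically closed `K` by this seat's assembly (`…MohWindowShadePolyTerminates.lean`): an infinite
sequence carries a hit thread (res-L1-s46-pv-1), the thread carries the shade model walk (entrance door), the walk meets a formal `p`-fold
curve (gen-3 termination theorem), which contradicts isolatedness (res-D-pv-050's exit door). VACUITY: module docstring (VAC). [folklore] -/
def MohWindowSurfacePolyPermissiblyTerminates (p : ℕ) [Fact p.Prime] (K : Type u) [Field K] [CharP K p] : Prop :=
  PermissiblyTerminates (Regime.mohWindowSurfacePoly (p := p) (K := K))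

/-- Pure logic (antitonicity in the regime): o1's rung `MohWindowSurfaceInsepPermissiblyTerminates` implies the polynomial rung. [folklore] -/
theorem mohWindowSurfacePolyPermissiblyTerminates_of_insep (h : MohWindowSurfaceInsepPermissiblyTerminates p K) :
    MohWindowSurfacePolyPermissiblyTerminates p K :=
  permissiblyTerminates_antitone (fun A E hAE => Regime.mohWindowSurfacePoly_le A E hAE) h

/-- **The typed rungs from the résumé-free rung**: for EVERY notion instance `N` and reading `Rd`, the typed Th. 16.6 procedure with the
literal centre rule (`Terminates`) and the ∇-centred one (`TerminatesNabla`) have no infinite run inside the polynomial surface window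
regime. [folklore] -/
theorem terminates_and_terminatesNabla_of_mohWindowSurfacePolyPermissiblyTerminates
    (h : MohWindowSurfacePolyPermissiblyTerminates p K) (n : ℕ) (N : Notions.{u} n) (Rd : Reading p K N) :
    Terminates N Rd (Regime.mohWindowSurfacePoly (p := p) (K := K)) ∧
      TerminatesNabla N Rd (Regime.mohWindowSurfacePoly (p := p) (K := K)) :=
  ⟨terminates_of_permissiblyTerminates N Rd h, terminatesNabla_of_terminates (terminates_of_permissiblyTerminates N Rd h)⟩

end CampaignW46

end Summit.ResolutionOfSingularities.ResolutionOfSingularities.Theorems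

end
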